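import Literature.Probability.Percolation.AdjNearZone
import Literature.Probability.Percolation.AdjSpokeMeetsD
import Literature.Probability.Percolation.AdjFrameTable
import Literature.Probability.Percolation.AdjFarGlue
import HarnessLib

/-!
# The open path of one corridor system, from the fenced exit to the target top row

Topic `Literature/Probability/Percolation`; family `crit-perc` / near-critical percolation on `𝕋`.
A brick of the near-critical arm-separation theorem for four arms in the ADJACENT colour
arrangement (P. Nolin, EJP 13 (2008), Thm. 11, `j = 4`, `σ = BBWW` [arXiv 0711.4948: Thm. 10]),
landing step. One corridor system of a fenced exit (type `A`; the exit read in a dihedral reading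
`χ = readingConfig b a ω'` of the rotated configuration `ω'`, the far structures in `ω'`): when its
near tube(s), its spoke, the arc, the approach and the target tube are all crossed, there is an
open path of `ω'` from (the image of) a site of the exit's structure — the fence site `m` for the
system `β` (`adj_systemB_path`), a site of the fence connection `F` for the system `α`
(`adj_systemA_path`) — to a site of the top row of the target tube, inside the union of (the images
of) the near boxes and the far boxes. Ingredients: `TermFenceT.spokeB_meets` /
`TermFence.nearA_meets` (the near structure is caught), `spoke_junctionRot` / `spoke_junctionRS`
(the spoke meets the entry tube of the arc), `adj_far_path` (along the arc into the approach and
up the target tube). Also the unified reading vocabulary `readingConfig`, `SpokeMeetsD`,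
`pathIn_of_readingConfig`, `spoke_junctionD`. Everything here is proved.

## References

* P. Nolin, Near-critical percolation in two dimensions, *Electron. J. Probab.* 13 (2008), §4.3
  Prop. 12 (proof), §4.4 (arXiv 0711.4948: Prop. 11; proof of Thm. 10) [Nolin2008].
* H. Kesten, *Percolation theory for mathematicians* (1982), §2.2 [KestenPTM1982].
-/

noncomputable section

open Set

namespace Literature.Probability.Percolation

open LatticeModels Tube

/-! ### Unified readings -/

/-- **The configuration read through a dihedral reading** (`false`: `ρ^a`; `true`: `ρ^a ∘ σ`). [folklore] -/
def readingConfig (b : Bool) (a : ℕ) (ω : SiteConfig (Site 2)) : SiteConfig (Site 2) :=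
  bif b then rswConfig a ω else rotConfig a ω

/-- Membership in a reading. [folklore] -/
@[simp] theorem mem_readingConfig {b : Bool} {a : ℕ} {ω : SiteConfig (Site 2)} {v : Site 2} :
    v ∈ readingConfig b a ω ↔ readingIso b a v ∈ ω := by
  cases b
  · simp [readingConfig, readingIso]
  · simp [readingConfig, readingIso]

/-- The framed configuration is the reading `frameReading i r` of the `r`-rotated configuration. [folklore] -/
theorem frameConfig_eq_readingConfig {i : ℕ} (hi : i < 6) (r : ℕ) (ω : SiteConfig (Site 2)) :
    frameConfig i ω = readingConfig (frameReading i r).1 (frameReading i r).2 (rotConfig r ω) := by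
  rw [frameConfig_eq_reading hi]; rfl

/-- **Back to the rotated frame** along a reading. [folklore] -/
theorem pathIn_of_readingConfig (b : Bool) (a : ℕ) {A : Set (Site 2)} {ω : SiteConfig (Site 2)} {x y : Site 2}
    (h : PathIn triGraph (A ∩ readingConfig b a ω) x y) :
    PathIn triGraph ((readingIso b a '' A) ∩ ω) (readingIso b a x) (readingIso b a y) := by
  have h' : PathIn triGraph (A ∩ {v | v ∈ readingConfig b a ω ↔ true}) x y := h.mono fun v hv => ⟨hv.1, by simpa using hv.2⟩
  cases b
  · exact (pathIn_of_rotConfig a h').mono fun v hv => ⟨hv.1, by simpa using hv.2⟩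
  · exact (pathIn_of_rswConfig a h').mono fun v hv => ⟨hv.1, by simpa using hv.2⟩

/-- **The junction condition of a reading.** [folklore] -/
def SpokeMeetsD (b : Bool) (a : ℕ) (Sp E : Tube) : Prop := bif b then SpokeMeetsRS a Sp E else SpokeMeetsRot a Sp E

/-- **The spoke–entry junction of a reading** (`a < 6`). [cite: Nolin2008, §4.3 Prop. 12 (proof) (arXiv 0711.4948: Prop. 11)] -/
theorem spoke_junctionD {b : Bool} {a : ℕ} (ha : a < 6) {Sp E : Tube} (hSph : Sp.horiz = true) {χ : SiteConfig (Site 2)}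
    {x' y' : Site 2} (hcr : Sp.IsCrossing (readingConfig b a χ) x' y')
    {xE yE : Site 2} (hE : E.IsCrossing χ xE yE) (hJ : SpokeMeetsD b a Sp E) :
    PathIn triGraph ((readingIso b a '' Sp.box ∪ E.box) ∩ χ) (readingIso b a x') xE := by
  cases b
  · exact spoke_junctionRot ha hSph hcr hE hJ
  · exact spoke_junctionRS ha hSph hcr hE hJ

/-! ### The system `β` of an exit of type `A` -/

/-- **The open path of the system `β`.** Exit: a term fence `T` with a tall crossing, read in the
reading `(b, a)` of `ω'` (`k ≥ 2`, tip on `trapO M`); spoke `spokeTubeB M k β L (2ε)`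
(`= adjSpoke (2M + k) (β + ε) L ε`, rows inside `[z₁ + 1, z₁ + k - 1]`, `L ≥ 2k`) crossed in the
reading; entry tube `Te` of a crossed chain `E :: L'` of `ω'` with the junction condition; run,
approach, target as in `adj_far_path`. Then `ω'` has an open path from the image of the fence site
`m` to a site of the top row of the target tube inside the images of the tall box and the spoke box
and the far boxes. [cite: Nolin2008, §4.3 Prop. 12, §4.4 (arXiv 0711.4948: Prop. 11; proof of Thm. 10)] -/
theorem adj_systemB_path {b : Bool} {a : ℕ} (ha : a < 6) {ω' : SiteConfig (Site 2)}
    {M k : ℕ} {c : Finset (Site 2)} {z : Site 2} {S : Set (Site 2)}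
    (T : TermFenceT M c z k (readingConfig b a ω') S) (hk : 2 ≤ k) (hz : z ∈ trapO M)
    {β : ℤ} {L ε : ℕ} (hL : 2 * k ≤ L) (hβ : z 1 + 1 ≤ β) (hβε : β + 2 * ε ≤ z 1 + k - 1)
    (hSp : readingConfig b a ω' ∈ (spokeTubeB M k β L (2 * ε)).event)
    {E : Tube} {L' : List Tube} (hch : List.IsChain Crosses (E :: L'))
    {X Y : Tube → Site 2} (hXY : ∀ U ∈ E :: L', U.IsCrossing ω' (X U) (Y U)) {Te : Tube} (hTe : Te ∈ E :: L')
    (hJ : SpokeMeetsD b a (spokeTubeB M k β L (2 * ε)) Te)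
    {r e s j₀ d : ℕ} {t : ℤ} {W h N' : ℕ} (hSL : ∀ U ∈ vchunks r (-(r : ℤ)) e s j₀ (d + 1), U ∈ E :: L')
    (hlo : -(r : ℤ) + j₀ * s - e ≤ t - 2 * h) (hhi : t - h - 1 ≤ -(r : ℤ) + (j₀ + d) * s - e) (hh : 2 ≤ h) (hWe : 3 * e ≤ W)
    (hH : ω' ∈ (adjApproach r e t W h).event) (hcr : Crosses (adjApproach r e t W h) (adjTarget N' t h))
    (hV : ω' ∈ (adjTarget N' t h).event) :
    ∃ y : Site 2, y 1 = t + h ∧ y ∈ (adjTarget N' t h).box ∧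
      PathIn triGraph ((readingIso b a '' (triStrip (z 0 + k) (z 1 + 1) k (2 * k - 1) ∪ (spokeTubeB M k β L (2 * ε)).box) ∪
        (boxAll (E :: L') ∪ (adjApproach r e t W h).box ∪ (adjTarget N' t h).box)) ∩ ω') (readingIso b a T.m) y := by
  -- the spoke crossing and the catch
  obtain ⟨xS, yS, hcrS⟩ := (spokeTubeB M k β L (2 * ε)).exists_isCrossing hSp
  obtain ⟨Bs, hBs, hmB, hstar, v, hvB, hPv⟩ := T.spokeB_meets hk hz hL hβ (by omega) hcrS
  -- (1) `m → v` inside the tall box, read back in `ω'`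
  have P1 : PathIn triGraph ((readingIso b a '' triStrip (z 0 + k) (z 1 + 1) k (2 * k - 1)) ∩ ω') (readingIso b a T.m) (readingIso b a v) :=
    pathIn_of_readingConfig b a ((hstar v hvB).mono hBs)
  -- (2) `v → xS` inside the spoke box
  have P2 : PathIn triGraph ((readingIso b a '' (spokeTubeB M k β L (2 * ε)).box) ∩ ω') (readingIso b a v) (readingIso b a xS) :=
    pathIn_of_readingConfig b a hPv.symm
  -- (3) the junction
  have P3 : PathIn triGraph ((readingIso b a '' (spokeTubeB M k β L (2 * ε)).box ∪ Te.box) ∩ ω') (readingIso b a xS) (X Te) :=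
    spoke_junctionD ha rfl hcrS (hXY Te hTe) hJ
  -- (4) the far path
  obtain ⟨y, hy1, hyb, P4⟩ := adj_far_path hch hXY hTe hSL hlo hhi hh hWe hH hcr hV
  refine ⟨y, hy1, hyb, ?_⟩
  have hTeA : Te.box ⊆ boxAll (E :: L') := fun w hw => ⟨Te, hTe, hw⟩
  refine ((P1.mono ?_).trans (P2.mono ?_)).trans ((P3.mono ?_).trans (P4.mono ?_))
  · rintro w ⟨⟨u, hu, rfl⟩, hw⟩; exact ⟨Or.inl ⟨u, Or.inl hu, rfl⟩, hw⟩
  · rintro w ⟨⟨u, hu, rfl⟩, hw⟩; exact ⟨Or.inl ⟨u, Or.inr hu, rfl⟩, hw⟩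
  · rintro w ⟨hw | hw, hw'⟩
    · obtain ⟨u, hu, rfl⟩ := hw; exact ⟨Or.inl ⟨u, Or.inr hu, rfl⟩, hw'⟩
    · exact ⟨Or.inr (Or.inl (Or.inl (hTeA hw))), hw'⟩
  · rintro w ⟨hw, hw'⟩; exact ⟨Or.inr hw, hw'⟩

/-! ### The system `α` of an exit of type `A` -/

/-- **The open path of the system `α`.** As `adj_systemB_path`, with the tall catch tube
`nearTubeA M z₁ k` crossed in the reading and the spoke `spokeTubeA M β L (2ε)` crossing it
(`k - 2 ≤ L`, rows inside `[z₁ + 1, z₁ + 3k]`), attachment of norm `≤ 2M`: an open path of `ω'`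
from the image of a site of the fence connection `F` to the target top row. [cite: Nolin2008, §4.3 Prop. 12, §4.4 (arXiv 0711.4948: Prop. 11; proof of Thm. 10)] -/
theorem adj_systemA_path {b : Bool} {a : ℕ} (ha : a < 6) {ω' : SiteConfig (Site 2)}
    {M k : ℕ} {c : Finset (Site 2)} {z : Site 2} {S : Set (Site 2)}
    (T : TermFence M c z k (readingConfig b a ω') S) (hk : 2 ≤ k) (hz : z ∈ trapO M) (hq : triNorm T.q ≤ 2 * M)
    (hN : readingConfig b a ω' ∈ (nearTubeA M (z 1) k).event)
    {β : ℤ} {L ε : ℕ} (hL : k - 2 ≤ L) (hβ : z 1 + 1 ≤ β) (hβε : β + 2 * ε ≤ z 1 + 3 * k)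
    (hSp : readingConfig b a ω' ∈ (spokeTubeA M β L (2 * ε)).event)
    {E : Tube} {L' : List Tube} (hch : List.IsChain Crosses (E :: L'))
    {X Y : Tube → Site 2} (hXY : ∀ U ∈ E :: L', U.IsCrossing ω' (X U) (Y U)) {Te : Tube} (hTe : Te ∈ E :: L')
    (hJ : SpokeMeetsD b a (spokeTubeA M β L (2 * ε)) Te)
    {r e s j₀ d : ℕ} {t : ℤ} {W h N' : ℕ} (hSL : ∀ U ∈ vchunks r (-(r : ℤ)) e s j₀ (d + 1), U ∈ E :: L')
    (hlo : -(r : ℤ) + j₀ * s - e ≤ t - 2 * h) (hhi : t - h - 1 ≤ -(r : ℤ) + (j₀ + d) * s - e) (hh : 2 ≤ h) (hWe : 3 * e ≤ W)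
    (hH : ω' ∈ (adjApproach r e t W h).event) (hcr : Crosses (adjApproach r e t W h) (adjTarget N' t h))
    (hV : ω' ∈ (adjTarget N' t h).event) :
    ∃ v ∈ T.F, ∃ y : Site 2, y 1 = t + h ∧ y ∈ (adjTarget N' t h).box ∧
      PathIn triGraph ((readingIso b a '' ((nearTubeA M (z 1) k).box ∪ (spokeTubeA M β L (2 * ε)).box) ∪
        (boxAll (E :: L') ∪ (adjApproach r e t W h).box ∪ (adjTarget N' t h).box)) ∩ ω') (readingIso b a v) y := by
  obtain ⟨xN, yN, hcrN⟩ := (nearTubeA M (z 1) k).exists_isCrossing hN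
  obtain ⟨xS, yS, hcrS⟩ := (spokeTubeA M β L (2 * ε)).exists_isCrossing hSp
  obtain ⟨v, hvN, hvF, hPv⟩ := T.nearA_meets hk hz hq hcrN
  -- (1) `v → xN` inside the catch tube
  have P1 : PathIn triGraph ((readingIso b a '' (nearTubeA M (z 1) k).box) ∩ ω') (readingIso b a v) (readingIso b a xN) := pathIn_of_readingConfig b a hPv.symm
  -- (2) relay to the spoke crossing start
  have hrel := relay (crosses_nearTubeA_spokeTubeA (M := M) (t := z 1) (b := β) (h := 2 * ε) hk hL hβ hβε) hcrN hcrS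
  have P2 : PathIn triGraph ((readingIso b a '' ((nearTubeA M (z 1) k).box ∪ (spokeTubeA M β L (2 * ε)).box)) ∩ ω') (readingIso b a xN) (readingIso b a xS) :=
    pathIn_of_readingConfig b a hrel
  -- (3) the junction
  have P3 : PathIn triGraph ((readingIso b a '' (spokeTubeA M β L (2 * ε)).box ∪ Te.box) ∩ ω') (readingIso b a xS) (X Te) :=
    spoke_junctionD ha rfl hcrS (hXY Te hTe) hJ
  -- (4) the far path
  obtain ⟨y, hy1, hyb, P4⟩ := adj_far_path hch hXY hTe hSL hlo hhi hh hWe hH hcr hV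
  refine ⟨v, hvF, y, hy1, hyb, ?_⟩
  have hTeA : Te.box ⊆ boxAll (E :: L') := fun w hw => ⟨Te, hTe, hw⟩
  refine ((P1.mono ?_).trans (P2.mono ?_)).trans ((P3.mono ?_).trans (P4.mono ?_))
  · rintro w ⟨⟨u, hu, rfl⟩, hw⟩; exact ⟨Or.inl ⟨u, Or.inl hu, rfl⟩, hw⟩
  · rintro w ⟨⟨u, hu, rfl⟩, hw⟩; exact ⟨Or.inl ⟨u, hu, rfl⟩, hw⟩
  · rintro w ⟨hw | hw, hw'⟩
    · obtain ⟨u, hu, rfl⟩ := hw; exact ⟨Or.inl ⟨u, Or.inr hu, rfl⟩, hw'⟩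
    · exact ⟨Or.inr (Or.inl (Or.inl (hTeA hw))), hw'⟩
  · rintro w ⟨hw, hw'⟩; exact ⟨Or.inr hw, hw'⟩

end Literature.Probability.Percolation
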